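import Mathlib
import Literature.AlgebraicGeometry.Tropical.InitialIdeal
import Literature.AlgebraicGeometry.Tropical.TropicalLink
import Summits.ResolutionOfSingularities.ResolutionOfSingularities.Theorems.TropicalLinksInductiveStepRayDegenerationGen

/-!
# TropicalLinks / InductiveStep — the ray degeneration is the special fibre of the partial
# compactification (Gröbner dictionary, brick B4, part 2 of 2)

Route `ResolutionOfSingularities/TropicalLinks`, crux `InductiveStep` (stmt-ResolutionOfSingularities-17233),
line `split`, in support of stub `stub_sncClosureSchon` (Luxton–Qu: an snc compactification with
unimodular boundary makes the principal open schön).  The schön clause asks that EVERY initial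
degeneration `k[x^±] ⧸ in_w(I')` be regular.  After a unimodular change of coordinates
(`tropicalLinks_isSchonIdeal_map_domCongr_iff`) a nonzero weight is a positive multiple of the first
coordinate `e₁`, and the present file identifies the degeneration along such a RAY with a geometric
object: on the split torus `T = 𝔾_m × T_L` with exponent lattice `ℤ × L` and weight
`φ = fst : ℤ × L → ℤ` (min-convention initial forms of `Tropical/InitialIdeal`),

* `tropicalLinks_linkIdeal_initialIdeal_fst_eq` — **the link of the ray degeneration is the special
  fibre**: `linkIdeal inr (in_fst J) = linkIdeal inr ((J ∩ k[ℕ × L]) + (x₁))` as ideals of `k[L]`;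
  in words, for `J ⊆ k[x₁^±, y^±]` the part of `in_{e₁}(J)` living on the sublattice `{0} × L` is the
  ideal of the scheme-theoretic fibre `{x₁ = 0}` of the closure `V(J ∩ k[x₁, y^±]) ⊆ 𝔸¹ × T_L` of
  `V(J)` in the partial compactification `𝔸¹ × T_L ⊇ 𝔾_m × T_L`;
* `tropicalLinks_initialIdeal_fst_isHomogeneous` — `in_fst(J)` is homogeneous for the `fst`-grading
  (so the torus-factor splitting `Tropical.quotientEquivOfIsHomogeneous` applies), whence
* `tropicalLinks_nonempty_quotient_initialIdeal_fst_algEquiv` —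
  `k[ℤ × L] ⧸ in_fst(J) ≃ₐ[k] (k[L] ⧸ fibre ideal)[ℤ]`: **the initial degeneration along a coordinate
  ray is `𝔾_m ×` (special fibre of the partial compactification)** — the standard dictionary between
  Gröbner degenerations and flat limits `lim_{t → 0} t^{-w} · V(J)` (Maclagan–Sturmfels, *Introduction
  to Tropical Geometry*, §2.4–§3; Helm–Katz 2012, §3), here as pure commutative algebra.

All statements are over a commutative ring `k` and an arbitrary additive commutative group `L` of
exponents; no new definitions (the fibre ideal is written with the tree's `Tropical.linkIdeal`).
-/

-- single-problem summit: the doubled namespace component `ResolutionOfSingularities` is forced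
set_option linter.dupNamespace false

namespace Summit.ResolutionOfSingularities.ResolutionOfSingularities.Theorems

open AddMonoidAlgebra DirectSum Literature.AlgebraicGeometry.Tropical

section RayDegeneration

variable {k : Type} [CommRing k] {L : Type} [AddCommGroup L]

/-- **Key step.** For `h ∈ k[ℤ × L]` and `f ∈ J`, the degree-`0` component of `h · in_fst(f)` is
`k[inr](r)` for some `r` in the fibre ideal: shift `f` by the monomial `x^{(-d,0)}` (`d` the minimal
`x₁`-degree of `f`) to reduce to the generator case. [folklore] -/
theorem tropicalLinks_exists_decompose_mul_initialForm_fst_eq (J : Ideal (AddMonoidAlgebra k (ℤ × L)))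
    (h : AddMonoidAlgebra k (ℤ × L)) {f : AddMonoidAlgebra k (ℤ × L)} (hf : f ∈ J) :
    ∃ r ∈ linkIdeal (AddMonoidHom.inr ℕ L)
        (linkIdeal ((Nat.castAddMonoidHom ℤ).prodMap (AddMonoidHom.id L)) J ⊔
          Ideal.span {single ((1 : ℕ), (0 : L)) (1 : k)}),
      ((decompose (gradeBy k (AddMonoidHom.fst ℤ L)) (h * initialForm (AddMonoidHom.fst ℤ L) f) 0 :
          gradeBy k (AddMonoidHom.fst ℤ L) 0) : AddMonoidAlgebra k (ℤ × L)) =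
        mapDomain (AddMonoidHom.inr ℤ L) r := by
  set φ := AddMonoidHom.fst ℤ L with hφ_def
  have hφ : ∀ u : ℤ × L, φ u = u.1 := fun u => rfl
  by_cases hf0 : f = 0
  · refine ⟨0, Ideal.zero_mem _, ?_⟩
    rw [hf0, initialForm_zero, mul_zero, decompose_zero, DirectSum.zero_apply, Submodule.coe_zero,
      mapDomain_zero]
  have hne : f.coeff.support.Nonempty := by
    rw [Finsupp.support_nonempty_iff, ne_eq, coeff_eq_zero]
    exact hf0
  obtain ⟨m₀, hm₀, hmin⟩ := f.coeff.support.exists_min_image φ hne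
  set d : ℤ := φ m₀ with hd_def
  have hF : initialForm φ f ∈ gradeBy k φ d := by
    rw [initialForm_eq_decompose φ hm₀ hmin]
    exact (decompose (gradeBy k φ) f d).2
  -- the degree-0 component of `h * in(f)` is `h_{-d} * in(f)`
  have key := coe_decompose_mul_add_of_right_mem (gradeBy k φ) (a := h) (i := -d) hF
  rw [neg_add_cancel] at key
  rw [key]
  set h' : AddMonoidAlgebra k (ℤ × L) := ((decompose (gradeBy k φ) h (-d) : gradeBy k φ (-d)) :
    AddMonoidAlgebra k (ℤ × L)) with hh'_def
  have hh'mem : h' ∈ gradeBy k φ (-d) := (decompose (gradeBy k φ) h (-d)).2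
  clear_value h'
  -- untwist: `h' * in(f) = (h' x^{(d,0)}) * (x^{(-d,0)} in(f))`
  have hxd : single ((d, 0) : ℤ × L) (1 : k) * single ((-d, 0) : ℤ × L) (1 : k) = 1 := by
    rw [single_mul_single, AddMonoidAlgebra.one_def, mul_one, Prod.mk_add_mk, add_neg_cancel, add_zero,
      Prod.mk_zero_zero]
  have hA : h' * single ((d, 0) : ℤ × L) (1 : k) ∈ gradeBy k φ 0 := by
    have h1 := SetLike.mul_mem_graded hh'mem (single_mem_gradeBy (R := k) φ ((d, 0) : ℤ × L) (1 : k))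
    rwa [hφ, neg_add_cancel] at h1
  set c : AddMonoidAlgebra k L := mapDomain (AddMonoidHom.snd ℤ L) (h' * single ((d, 0) : ℤ × L) (1 : k))
    with hc_def
  have hc : mapDomain (AddMonoidHom.inr ℤ L) c = h' * single ((d, 0) : ℤ × L) (1 : k) :=
    mapDomain_inr_mapDomain_snd_of_mem_gradeBy_zero hA
  clear_value c
  -- the shifted element `f' = x^{(-d,0)} f ∈ J` has minimal degree 0
  set f' : AddMonoidAlgebra k (ℤ × L) := single ((-d, 0) : ℤ × L) (1 : k) * f with hf'_def
  have hf' : f' ∈ J := Ideal.mul_mem_left _ _ hf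
  have hsupp' : ∀ u : ℤ × L, u ∈ f'.coeff.support ↔ -((-d, 0) : ℤ × L) + u ∈ f.coeff.support := by
    intro u
    rw [hf'_def, Finsupp.mem_support_iff, Finsupp.mem_support_iff, coeff_single_mul_apply, one_mul]
  have hneg : -((-d, 0) : ℤ × L) = ((d, 0) : ℤ × L) := by
    rw [Prod.neg_mk, neg_neg, neg_zero]
  have h0' : ∀ u ∈ f'.coeff.support, 0 ≤ u.1 := by
    intro u hu
    have h1 := hmin _ ((hsupp' u).1 hu)
    rw [hneg, map_add, hφ, hφ] at h1
    change d ≤ d + u.1 at h1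
    linarith
  have hm₀' : ((-d, 0) : ℤ × L) + m₀ ∈ f'.coeff.support :=
    (hsupp' _).2 (by rwa [neg_add_cancel_left])
  have hd' : (((-d, 0) : ℤ × L) + m₀).1 = 0 := by
    change -d + m₀.1 = 0
    rw [hd_def, hφ, neg_add_cancel]
  obtain ⟨r₀, hr₀, hr₀eq⟩ := tropicalLinks_exists_initialForm_fst_eq_mapDomain_inr k L J f' hf' h0' _ hm₀' hd'
  have hB : single ((-d, 0) : ℤ × L) (1 : k) * initialForm φ f = mapDomain (AddMonoidHom.inr ℤ L) r₀ := by
    rw [← tropicalLinks_initialForm_single_one_mul]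
    exact hr₀eq
  refine ⟨c * r₀, Ideal.mul_mem_left _ _ hr₀, ?_⟩
  calc h' * initialForm φ f
      = (h' * single ((d, 0) : ℤ × L) (1 : k)) * (single ((-d, 0) : ℤ × L) (1 : k) * initialForm φ f) := by
        rw [mul_assoc, ← mul_assoc (single ((d, 0) : ℤ × L) (1 : k)), hxd, one_mul]
    _ = mapDomain (AddMonoidHom.inr ℤ L) c * mapDomain (AddMonoidHom.inr ℤ L) r₀ := by rw [hc, hB]
    _ = mapDomain (AddMonoidHom.inr ℤ L) (c * r₀) := by rw [mapDomain_mul]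

/-- **The link of the ray degeneration is the special fibre of the partial compactification**
(brick B4a).  For an ideal `J ⊆ k[ℤ × L] = k[x₁^±, y^±]` and the weight `fst` (the coordinate ray
`e₁`, min-convention), the restriction to `k[L] = k[y^±]` of the initial ideal `in_{e₁}(J)` equals
the restriction to `k[L]` of `(J ∩ k[x₁, y^±]) + (x₁) ⊆ k[ℕ × L] = k[x₁, y^±]`, i.e. the ideal of
the scheme-theoretic fibre over `x₁ = 0` of the closure of `V(J)` in `𝔸¹ × T_L`.  Together with the
torus-factor splitting (`Tropical.quotientEquivOfIsHomogeneous`): `in_{e₁} V(J) ≅ 𝔾_m ×` (that fibre).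
[folklore] -/
theorem tropicalLinks_linkIdeal_initialIdeal_fst_eq :
    ∀ (k : Type) [CommRing k] (L : Type) [AddCommGroup L] (J : Ideal (AddMonoidAlgebra k (ℤ × L))), Literature.AlgebraicGeometry.Tropical.linkIdeal (AddMonoidHom.inr ℤ L) (Literature.AlgebraicGeometry.Tropical.initialIdeal (AddMonoidHom.fst ℤ L) J) = Literature.AlgebraicGeometry.Tropical.linkIdeal (AddMonoidHom.inr ℕ L) (Literature.AlgebraicGeometry.Tropical.linkIdeal ((Nat.castAddMonoidHom ℤ).prodMap (AddMonoidHom.id L)) J ⊔ Ideal.span {AddMonoidAlgebra.single ((1 : ℕ), (0 : L)) (1 : k)}) := by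
  intro k _ L _ J
  classical
  set castP := (Nat.castAddMonoidHom ℤ).prodMap (AddMonoidHom.id L) with hcastP_def
  have hcastP : ∀ u : ℕ × L, castP u = ((u.1 : ℤ), u.2) := fun u => rfl
  have hinrZ : Function.Injective (AddMonoidHom.inr ℤ L) := fun a b hab => (Prod.ext_iff.1 hab).2
  have hGsupp : ∀ (g : AddMonoidAlgebra k L), ∀ u ∈ (mapDomain (AddMonoidHom.inr ℤ L) g).coeff.support,
      u.1 = 0 := by
    intro g u hu
    rw [coeff_mapDomain] at hu
    obtain ⟨l, -, rfl⟩ := Finset.mem_image.1 (Finsupp.mapDomain_support hu)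
    rfl
  apply le_antisymm
  · -- `⊆`: a degree-0 element of `in(J)` is the degree-0 part of an element of `J ∩ k[x₁, y^±]`
    intro g hg
    rw [mem_linkIdeal_iff] at hg
    have main : ∀ F ∈ initialIdeal (AddMonoidHom.fst ℤ L) J, ∀ h : AddMonoidAlgebra k (ℤ × L),
        ∃ r ∈ linkIdeal (AddMonoidHom.inr ℕ L) (linkIdeal castP J ⊔
          Ideal.span {single ((1 : ℕ), (0 : L)) (1 : k)}),
        ((decompose (gradeBy k (AddMonoidHom.fst ℤ L)) (h * F) 0 : gradeBy k (AddMonoidHom.fst ℤ L) 0) :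
          AddMonoidAlgebra k (ℤ × L)) = mapDomain (AddMonoidHom.inr ℤ L) r := by
      intro F hF
      unfold initialIdeal at hF
      refine Submodule.span_induction ?_ ?_ ?_ ?_ hF
      · rintro _ ⟨f, hf, rfl⟩ h
        exact tropicalLinks_exists_decompose_mul_initialForm_fst_eq J h hf
      · intro h
        refine ⟨0, Ideal.zero_mem _, ?_⟩
        rw [mul_zero, decompose_zero, DirectSum.zero_apply, Submodule.coe_zero, mapDomain_zero]
      · intro x y _ _ hx hy h
        obtain ⟨r₁, hr₁, e₁⟩ := hx h
        obtain ⟨r₂, hr₂, e₂⟩ := hy h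
        refine ⟨r₁ + r₂, Ideal.add_mem _ hr₁ hr₂, ?_⟩
        rw [mul_add, decompose_add, DirectSum.add_apply, Submodule.coe_add, e₁, e₂, mapDomain_add]
      · intro a x _ hx h
        obtain ⟨r, hr, e⟩ := hx (h * a)
        refine ⟨r, hr, ?_⟩
        rw [smul_eq_mul, ← mul_assoc]
        exact e
    obtain ⟨r, hr, e⟩ := main _ hg 1
    have hG0 : mapDomain (AddMonoidHom.inr ℤ L) g ∈ gradeBy k (AddMonoidHom.fst ℤ L) 0 := hGsupp g
    rw [one_mul, decompose_of_mem_same _ hG0] at e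
    rw [mapDomain_injective hinrZ e]
    exact hr
  · -- `⊇`: the degree-0 part of an element of `J ∩ k[x₁, y^±]` is its initial form
    intro g hg
    rw [mem_linkIdeal_iff] at hg ⊢
    obtain ⟨a, ha, b, hb, hab⟩ := Submodule.mem_sup.1 hg
    obtain ⟨c, rfl⟩ := Ideal.mem_span_singleton'.1 hb
    by_cases hg0 : g = 0
    · rw [hg0, mapDomain_zero]
      exact Ideal.zero_mem _
    set f : AddMonoidAlgebra k (ℤ × L) := mapDomain castP a with hf_def
    have hfJ : f ∈ J := (mem_linkIdeal_iff _ _ _).1 ha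
    suffices hin : initialForm (AddMonoidHom.fst ℤ L) f = mapDomain (AddMonoidHom.inr ℤ L) g by
      rw [← hin]
      exact initialForm_mem_initialIdeal _ hfJ
    -- `f = G - H` with `G = k[inr] g` of degree 0 and `H` of degrees ≥ 1
    set G : AddMonoidAlgebra k (ℤ × L) := mapDomain (AddMonoidHom.inr ℤ L) g with hG_def
    set H : AddMonoidAlgebra k (ℤ × L) := mapDomain castP c * single ((1 : ℤ), (0 : L)) (1 : k)
      with hH_def
    have hGH : f = G - H := by
      have e1 : a = mapDomain (AddMonoidHom.inr ℕ L) g - c * single ((1 : ℕ), (0 : L)) (1 : k) := by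
        rw [← hab, add_sub_cancel_right]
      have e2 : mapDomain castP (mapDomain (AddMonoidHom.inr ℕ L) g) = G := by
        apply coeff_injective
        rw [hG_def, coeff_mapDomain, coeff_mapDomain, coeff_mapDomain,
          ← Finsupp.mapDomain_comp (f := ⇑(AddMonoidHom.inr ℕ L)) (g := ⇑castP)]
        refine Finsupp.mapDomain_congr fun l _ => ?_
        rw [Function.comp_apply, hcastP]
        rfl
      rw [hf_def, e1]
      change mapDomainRingHom k castP _ = _
      rw [map_sub, map_mul]
      change mapDomain castP _ - mapDomain castP c * mapDomain castP _ = _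
      rw [e2, mapDomain_single, hcastP]
      simp only [Nat.cast_one]
      rfl
    have hHsupp : ∀ u ∈ H.coeff.support, 1 ≤ u.1 := by
      intro u hu
      rw [hH_def, Finsupp.mem_support_iff, coeff_mul_single_apply, mul_one] at hu
      have hu' : u + -((1 : ℤ), (0 : L)) ∈ (mapDomain castP c).coeff.support := Finsupp.mem_support_iff.2 hu
      rw [coeff_mapDomain] at hu'
      obtain ⟨v, -, hv⟩ := Finset.mem_image.1 (Finsupp.mapDomain_support hu')
      have h1 : (v.1 : ℤ) = u.1 + -1 := by
        have := congrArg Prod.fst hv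
        rw [hcastP] at this
        exact this
      have h2 : (0 : ℤ) ≤ v.1 := Int.natCast_nonneg _
      linarith
    have hfsupp : ∀ u ∈ f.coeff.support, 0 ≤ u.1 := by
      intro u hu
      rw [hGH, coeff_sub, Finsupp.mem_support_iff, Finsupp.sub_apply] at hu
      by_cases huG : u ∈ G.coeff.support
      · rw [hGsupp g u huG]
      · rw [Finsupp.notMem_support_iff.1 huG, zero_sub, neg_ne_zero] at hu
        have := hHsupp u (Finsupp.mem_support_iff.2 hu)
        linarith
    -- an exponent of degree 0
    have hGne : G.coeff.support.Nonempty := by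
      rw [Finsupp.support_nonempty_iff, ne_eq, coeff_eq_zero]
      intro hG0
      exact hg0 (mapDomain_injective hinrZ (by rw [mapDomain_zero]; exact hG0))
    obtain ⟨m₀, hm₀⟩ := hGne
    have hm₀d : m₀.1 = 0 := hGsupp g m₀ hm₀
    have hHm₀ : H.coeff m₀ = 0 := by
      by_contra hne
      have := hHsupp m₀ (Finsupp.mem_support_iff.2 hne)
      linarith
    have hm₀f : m₀ ∈ f.coeff.support := by
      rw [hGH, coeff_sub, Finsupp.mem_support_iff, Finsupp.sub_apply, hHm₀, sub_zero]
      exact Finsupp.mem_support_iff.1 hm₀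
    rw [tropicalLinks_initialForm_eq_filter_of_nonneg (AddMonoidHom.fst ℤ L) hfsupp hm₀f hm₀d]
    -- the degree-0 part of `G - H` is `G`
    apply coeff_injective
    ext u
    rw [coeff_ofCoeff, Finsupp.filter_apply, hGH, coeff_sub, Finsupp.sub_apply]
    by_cases hu : u.1 = 0
    · have hHu : H.coeff u = 0 := by
        by_contra hne
        have := hHsupp u (Finsupp.mem_support_iff.2 hne)
        linarith
      rw [if_pos (show (AddMonoidHom.fst ℤ L) u = 0 from hu), hHu, sub_zero]
    · have hGu : G.coeff u = 0 := by
        by_contra hne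
        exact hu (hGsupp g u (Finsupp.mem_support_iff.2 hne))
      rw [if_neg (show ¬ (AddMonoidHom.fst ℤ L) u = 0 from hu), hGu]

/-- The ray degeneration `in_fst(J)` is homogeneous for the `fst`-grading of `k[ℤ × L]` (it is
spanned by initial forms, which are homogeneous): `V(in_{e₁} J)` is invariant under the first
`𝔾_m`-factor (brick B4b). [folklore] -/
theorem tropicalLinks_initialIdeal_fst_isHomogeneous :
    ∀ (k : Type) [CommRing k] (L : Type) [AddCommGroup L] (J : Ideal (AddMonoidAlgebra k (ℤ × L))), (Literature.AlgebraicGeometry.Tropical.initialIdeal (AddMonoidHom.fst ℤ L) J).IsHomogeneous (AddMonoidAlgebra.gradeBy k (AddMonoidHom.fst ℤ L)) := by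
  intro k _ L _ J
  unfold initialIdeal
  exact Ideal.homogeneous_span (gradeBy k (AddMonoidHom.fst ℤ L)) _
    (by rintro _ ⟨f, -, rfl⟩; exact isHomogeneousElem_initialForm (AddMonoidHom.fst ℤ L) f)

/-- **The initial degeneration along a coordinate ray is `𝔾_m ×` the special fibre of the partial
compactification** (brick B4c, coordinate rings): for `J ⊆ k[ℤ × L] = k[x₁^±, y^±]`,
`k[ℤ × L] ⧸ in_{e₁}(J) ≃ₐ[k] (k[L] ⧸ 𝔣)[ℤ]` where `𝔣 ⊆ k[L]` is the ideal of the fibre `{x₁ = 0}`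
of `V(J ∩ k[x₁, y^±]) ⊆ 𝔸¹ × T_L` (the torus-factor splitting `Tropical.quotientEquivOfIsHomogeneous`
composed with `tropicalLinks_linkIdeal_initialIdeal_fst_eq`). [folklore] -/
theorem tropicalLinks_nonempty_quotient_initialIdeal_fst_algEquiv :
    ∀ (k : Type) [CommRing k] (L : Type) [AddCommGroup L] (J : Ideal (AddMonoidAlgebra k (ℤ × L))), Nonempty ((AddMonoidAlgebra k (ℤ × L) ⧸ Literature.AlgebraicGeometry.Tropical.initialIdeal (AddMonoidHom.fst ℤ L) J) ≃ₐ[k] AddMonoidAlgebra (AddMonoidAlgebra k L ⧸ (Literature.AlgebraicGeometry.Tropical.linkIdeal (AddMonoidHom.inr ℕ L) (Literature.AlgebraicGeometry.Tropical.linkIdeal ((Nat.castAddMonoidHom ℤ).prodMap (AddMonoidHom.id L)) J ⊔ Ideal.span {AddMonoidAlgebra.single ((1 : ℕ), (0 : L)) (1 : k)}))) ℤ) := by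
  intro k _ L _ J
  classical
  have e := quotientEquivOfIsHomogeneous (initialIdeal (AddMonoidHom.fst ℤ L) J)
    (tropicalLinks_initialIdeal_fst_isHomogeneous k L J)
  rw [tropicalLinks_linkIdeal_initialIdeal_fst_eq k L J] at e
  exact ⟨e⟩

end RayDegeneration

end Summit.ResolutionOfSingularities.ResolutionOfSingularities.Theorems
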